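import Mathlib
import HarnessLib
import Summits.Ventures.LatticeQCDFlow.Scoring.ChainTimeAverage
import Summits.Ventures.LatticeQCDFlow.Exactness.NCMCGeneralSpaceDoeblinPowerEveryStart
import Summits.Ventures.LatticeQCDFlow.Exactness.NCMCGeneralSpaceErgodicRunPairs

/-!
# The martingale inside a Markov chain: the increments `h(X_{t+1}) − (κh)(X_t)` are bounded, orthogonal to the past, telescope the time sum of `h − κh`, and their squares obey the law of large numbers from EVERY start under a Doeblin power

HONEST FRAMING: exact (Metropolis-corrected) sampling algorithms for lattice gauge theory;
figures of merit are autocorrelation/cost numbers at stated couplings and volumes; no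
continuum-physics claim.

Venture `LatticeQCDFlow` (cell pub-lqcd), topic `Exactness`; FANOUT row 13 (`eng-snf`, GEN-19).
NEW WORK of the cell, not a published result; no definition is introduced; nothing is cited as a
fact (the martingale decomposition of additive functionals of a Markov chain — Gordin 1969,
Maigret 1978, Meyn–Tweedie 1993 §17.4 — is NAMED ONLY).  The chain-side input of the Markov-chain
CLT under a Doeblin power (`NCMCGeneralSpaceDoeblinPowerCLT.lean`): it verifies, for Mathlib's
Ionescu-Tulcea chain law `P_{μ₀} = Kernel.trajMeasure μ₀ (n ↦ κ ∘ (x ↦ x n))` of row 8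
(`Scoring/ChainTimeAverage.lean`: the tower identity `Scoring.chain_tower`, `Scoring.chain_twoTime`,
`Scoring.chain_marginal`), the two hypotheses of the martingale CLT
`NCMCGeneralSpaceMartingaleCLT.tendstoInDistribution_sum_div_sqrt_of_orthogonal` for the increments
`D_t(x) = h(x_{t+1}) − (kop κ h)(x_t)` of a bounded measurable `h`: ORTHOGONALITY to every bounded
measurable function of `(D_0, …, D_{n−1})` under EVERY initial law (tower identity), and the almost
sure convergence of `(1/n) Σ_{t<n} D_t²` to `σ² = ∫ h² dπ − ∫ (kop κ h)² dπ` from EVERY initial law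
when `κ` has a Doeblin power (Birkhoff under `P_π` through GEN-17's two-time strong law
`tendsto_sum_pair_div_ae_of_ergodic` — the tree's PROVED Birkhoff theorem — and GEN-18's ergodicity
`ergodic_shift_chain_of_nHit_minorised`; then GEN-18's Liouville step
`trajMeasure_eq_one_of_nHit_minorised` carries the shift-invariant Cesàro event to every start).

## Content (`κ` Markov on `S`; `h` bounded measurable; `D_t(x) = h(x_{t+1}) − kop κ h (x_t)`)

* **`chain_increment_orthogonal`** — for EVERY initial law `μ₀`, every `n` and every bounded
  measurable `F : (Fin n → ℝ) → ℝ`: `∫ F(D_0, …, D_{n−1}) · D_n dP_{μ₀} = 0`.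
* `sum_centred_eq_sum_increment_add` — TELESCOPING: if `h − kop κ h = f` then
  `Σ_{t<n} f(x_t) = Σ_{t<n} D_t(x) + h(x_0) − h(x_n)`.
* **`chain_integral_increment_sq`** — `∫ D_0² dP_π = ∫ h² dπ − ∫ (kop κ h)² dπ` (`π` invariant);
  **`chain_incrementSq_ae_of_ergodic`** — if `P_π` is shift-ergodic,
  `(1/n) Σ_{t<n} D_t² → ∫ h² dπ − ∫ (kop κ h)² dπ` `P_π`-a.s.;
  **`chain_incrementSq_anyLaw_of_nHit`** — under a Doeblin power `(nHit κ m)(z, ·) ≥ ε ν` (`ε ≠ 0`)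
  the same limit holds `P_{μ₀}`-a.s. for EVERY initial law `μ₀`.

NOT CLAIMED: anything for unbounded `h`; rates.
-/

namespace Summit.Ventures.LatticeQCDFlow.Exactness.GeneralNCMC

open MeasureTheory ProbabilityTheory Set Filter Finset
open scoped ENNReal Topology

variable {S : Type*} [MeasurableSpace S]

/-! ## §1 Orthogonality of the increments to the past, and the telescoping identity -/

section Orthogonal

variable (κ : Kernel S S) [IsMarkovKernel κ] (μ₀ : Measure S) [IsProbabilityMeasure μ₀]

/-- **The increments `D_t = h(X_{t+1}) − (kop κ h)(X_t)` are orthogonal to their past**: for every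
initial law, every `n` and every bounded measurable `F : (Fin n → ℝ) → ℝ`,
`∫ F(D_0, …, D_{n−1}) · D_n dP_{μ₀} = 0` (the tower identity with a history functional). -/
theorem chain_increment_orthogonal {h : S → ℝ} (hh : Measurable h) {Ch : ℝ} (hCh : ∀ x, |h x| ≤ Ch)
    (n : ℕ) (F : (Fin n → ℝ) → ℝ) (K : ℝ) (hF : Measurable F) (hK : ∀ v, |F v| ≤ K) :
    ∫ x, F (fun i : Fin n => h (x ((i : ℕ) + 1)) - Scoring.kop κ h (x (i : ℕ))) *
        (h (x (n + 1)) - Scoring.kop κ h (x n))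
      ∂(Kernel.trajMeasure (X := fun _ : ℕ => S) μ₀
        (fun n : ℕ => κ.comap (fun hh : (i : ↥(Finset.Iic n)) → S => hh ⟨n, Finset.mem_Iic.2 le_rfl⟩)
          (measurable_pi_apply _))) = 0 := by
  set P := Kernel.trajMeasure (X := fun _ : ℕ => S) μ₀
    (fun n : ℕ => κ.comap (fun hh : (i : ↥(Finset.Iic n)) → S => hh ⟨n, Finset.mem_Iic.2 le_rfl⟩)
      (measurable_pi_apply _)) with hP
  -- the history functional
  set G : ((j : ↥(Finset.Iic n)) → S) → ℝ := fun hist =>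
    F (fun i : Fin n => h (hist ⟨(i : ℕ) + 1, Finset.mem_Iic.2 (by omega)⟩)
      - Scoring.kop κ h (hist ⟨(i : ℕ), Finset.mem_Iic.2 (by omega)⟩)) with hG
  have hKm := Scoring.measurable_kop κ hh
  have hGm : Measurable G := hF.comp (measurable_pi_lambda _ fun i =>
    (hh.comp (measurable_pi_apply _)).sub (hKm.comp (measurable_pi_apply _)))
  have hGK : ∀ hist, |G hist| ≤ K := fun hist => hK _
  have hGx : ∀ x : ℕ → S, G (Preorder.frestrictLe n x)
      = F (fun i : Fin n => h (x ((i : ℕ) + 1)) - Scoring.kop κ h (x (i : ℕ))) := fun x => rfl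
  have key := Scoring.chain_tower κ μ₀ n hGm hGK hh hCh
  rw [← hP] at key
  simp_rw [hGx] at key
  -- split the integral
  have hK0 : 0 ≤ K := (abs_nonneg _).trans (hK fun _ => 0)
  have hFm : Measurable fun x : ℕ → S =>
      F (fun i : Fin n => h (x ((i : ℕ) + 1)) - Scoring.kop κ h (x (i : ℕ))) :=
    hF.comp (measurable_pi_lambda _ fun i =>
      (hh.comp (measurable_pi_apply _)).sub (hKm.comp (measurable_pi_apply _)))
  have hint1 : Integrable (fun x : ℕ → S =>
      F (fun i : Fin n => h (x ((i : ℕ) + 1)) - Scoring.kop κ h (x (i : ℕ))) * h (x (n + 1))) P :=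
    Scoring.integrable_of_bounded P (hFm.mul (hh.comp (measurable_pi_apply _))) (C := K * Ch)
      fun x => by
        rw [abs_mul]; exact mul_le_mul (hK _) (hCh _) (abs_nonneg _) hK0
  have hint2 : Integrable (fun x : ℕ → S =>
      F (fun i : Fin n => h (x ((i : ℕ) + 1)) - Scoring.kop κ h (x (i : ℕ)))
        * Scoring.kop κ h (x n)) P :=
    Scoring.integrable_of_bounded P (hFm.mul (hKm.comp (measurable_pi_apply _))) (C := K * Ch)
      fun x => by
        rw [abs_mul]
        exact mul_le_mul (hK _) (Scoring.abs_kop_le κ hCh _) (abs_nonneg _) hK0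
  simp_rw [mul_sub]
  rw [integral_sub hint1 hint2, key, sub_self]

omit [MeasurableSpace S] in
/-- **Telescoping**: if `h − kop κ h = f` pointwise then
`Σ_{t<n} f(x_t) = Σ_{t<n} (h(x_{t+1}) − kop κ h (x_t)) + h(x_0) − h(x_n)`. -/
theorem sum_centred_eq_sum_increment_add (K : (S → ℝ) → S → ℝ) {f h : S → ℝ}
    (hpois : ∀ y, h y - K h y = f y) (x : ℕ → S) (n : ℕ) :
    ∑ t ∈ range n, f (x t) = (∑ t ∈ range n, (h (x (t + 1)) - K h (x t))) + h (x 0) - h (x n) := by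
  have htel := Finset.sum_range_sub' (fun t => h (x t)) n
  have h1 : ∑ t ∈ range n, f (x t) = ∑ t ∈ range n, (h (x t) - K h (x t)) :=
    Finset.sum_congr rfl fun t _ => (hpois (x t)).symm
  rw [h1]
  have h2 : ∑ t ∈ range n, (h (x t) - K h (x t))
      = ∑ t ∈ range n, (h (x (t + 1)) - K h (x t)) + ∑ t ∈ range n, (h (x t) - h (x (t + 1))) := by
    rw [← Finset.sum_add_distrib]
    exact Finset.sum_congr rfl fun t _ => by ring
  rw [h2, htel]
  ring

end Orthogonal

/-! ## §2 The law of large numbers for the squared increments -/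

section Squares

variable (κ : Kernel S S) [IsMarkovKernel κ] {π : Measure S} [IsProbabilityMeasure π]

/-- **`E_π[D_0²] = ∫ h² dπ − ∫ (kop κ h)² dπ`**: under the stationary chain law the first squared
increment integrates to the "conditional variance" form of the asymptotic variance. -/
theorem chain_integral_increment_sq (hπ : Kernel.Invariant κ π) {h : S → ℝ} (hh : Measurable h)
    {Ch : ℝ} (hCh : ∀ x, |h x| ≤ Ch) :
    ∫ x, (h (x 1) - Scoring.kop κ h (x 0)) ^ 2 ∂(Kernel.trajMeasure (X := fun _ : ℕ => S) π
        (fun n : ℕ => κ.comap (fun hh : (i : ↥(Finset.Iic n)) → S => hh ⟨n, Finset.mem_Iic.2 le_rfl⟩)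
          (measurable_pi_apply _)))
      = ∫ x, h x ^ 2 ∂π - ∫ x, (Scoring.kop κ h x) ^ 2 ∂π := by
  set P := Kernel.trajMeasure (X := fun _ : ℕ => S) π
    (fun n : ℕ => κ.comap (fun hh : (i : ↥(Finset.Iic n)) → S => hh ⟨n, Finset.mem_Iic.2 le_rfl⟩)
      (measurable_pi_apply _)) with hP
  haveI : IsProbabilityMeasure P := by rw [hP]; infer_instance
  have hCh0 : 0 ≤ Ch := (abs_nonneg _).trans (hCh (Classical.choice (nonempty_of_isProbabilityMeasure π)))
  have hKm := Scoring.measurable_kop κ hh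
  have hKb : ∀ x, |Scoring.kop κ h x| ≤ Ch := Scoring.abs_kop_le κ hCh
  have hsq : ∀ {g : S → ℝ}, (∀ x, |g x| ≤ Ch) → ∀ x, |g x ^ 2| ≤ Ch ^ 2 := fun hg x => by
    rw [abs_pow]; exact pow_le_pow_left₀ (abs_nonneg _) (hg x) 2
  -- the three pieces
  have h1 : ∫ x, h (x 1) ^ 2 ∂P = ∫ x, h x ^ 2 ∂π := by
    rw [hP]; exact Scoring.chain_marginal hπ 1 (hh.pow_const 2) (hsq hCh)
  have h2 : ∫ x, Scoring.kop κ h (x 0) * h (x 1) ∂P = ∫ x, (Scoring.kop κ h x) ^ 2 ∂π := by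
    have htt := Scoring.chain_twoTime κ π 0 hKm hKb 1 hh hCh
    simp only [Nat.zero_add, Function.iterate_one] at htt
    rw [hP, htt, ← hP]
    have : (fun x : ℕ → S => Scoring.kop κ h (x 0) * Scoring.kop κ h (x 0))
        = fun x => (fun y => Scoring.kop κ h y ^ 2) (x 0) := by funext x; ring
    rw [this, hP]
    exact Scoring.chain_marginal hπ 0 (hKm.pow_const 2) (hsq hKb)
  have h3 : ∫ x, (Scoring.kop κ h (x 0)) ^ 2 ∂P = ∫ x, (Scoring.kop κ h x) ^ 2 ∂π := by
    rw [hP]; exact Scoring.chain_marginal hπ 0 (hKm.pow_const 2) (hsq hKb)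
  -- integrability
  have hi1 : Integrable (fun x : ℕ → S => h (x 1) ^ 2) P :=
    Scoring.integrable_of_bounded P ((hh.comp (measurable_pi_apply 1)).pow_const 2)
      fun x => hsq hCh (x 1)
  have hi2 : Integrable (fun x : ℕ → S => Scoring.kop κ h (x 0) * h (x 1)) P :=
    Scoring.integrable_of_bounded P ((hKm.comp (measurable_pi_apply 0)).mul
      (hh.comp (measurable_pi_apply 1))) (C := Ch * Ch) fun x => by
        rw [abs_mul]; exact mul_le_mul (hKb _) (hCh _) (abs_nonneg _) hCh0
  have hi3 : Integrable (fun x : ℕ → S => (Scoring.kop κ h (x 0)) ^ 2) P :=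
    Scoring.integrable_of_bounded P ((hKm.comp (measurable_pi_apply 0)).pow_const 2)
      fun x => hsq hKb (x 0)
  have hexp : (fun x : ℕ → S => (h (x 1) - Scoring.kop κ h (x 0)) ^ 2)
      = fun x => h (x 1) ^ 2 - 2 * (Scoring.kop κ h (x 0) * h (x 1)) + (Scoring.kop κ h (x 0)) ^ 2 := by
    funext x; ring
  rw [hexp, integral_add (hi1.sub' (hi2.const_mul 2)) hi3, integral_sub hi1 (hi2.const_mul 2),
    integral_const_mul, h1, h2, h3]
  ring

/-- **LLN for the squared increments under the stationary ergodic chain**: if `P_π` is ergodic for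
the shift then `(1/n) Σ_{t<n} (h(x_{t+1}) − kop κ h (x_t))² → ∫ h² dπ − ∫ (kop κ h)² dπ` `P_π`-a.s. -/
theorem chain_incrementSq_ae_of_ergodic (hπ : Kernel.Invariant κ π)
    (hErg : Ergodic (fun (x : ℕ → S) (k : ℕ) => x (k + 1))
      (Kernel.trajMeasure (X := fun _ : ℕ => S) π
        (fun n : ℕ => κ.comap (fun hh : (i : ↥(Finset.Iic n)) → S => hh ⟨n, Finset.mem_Iic.2 le_rfl⟩)
          (measurable_pi_apply _))))
    {h : S → ℝ} (hh : Measurable h) {Ch : ℝ} (hCh : ∀ x, |h x| ≤ Ch) :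
    ∀ᵐ x ∂(Kernel.trajMeasure (X := fun _ : ℕ => S) π
        (fun n : ℕ => κ.comap (fun hh : (i : ↥(Finset.Iic n)) → S => hh ⟨n, Finset.mem_Iic.2 le_rfl⟩)
          (measurable_pi_apply _))),
      Tendsto (fun n : ℕ => (∑ t ∈ range n, (h (x (t + 1)) - Scoring.kop κ h (x t)) ^ 2) / n) atTop
        (𝓝 (∫ x, h x ^ 2 ∂π - ∫ x, (Scoring.kop κ h x) ^ 2 ∂π)) := by
  set P := Kernel.trajMeasure (X := fun _ : ℕ => S) π
    (fun n : ℕ => κ.comap (fun hh : (i : ↥(Finset.Iic n)) → S => hh ⟨n, Finset.mem_Iic.2 le_rfl⟩)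
      (measurable_pi_apply _)) with hP
  haveI : IsProbabilityMeasure P := by rw [hP]; infer_instance
  have hCh0 : 0 ≤ Ch := (abs_nonneg _).trans (hCh (Classical.choice (nonempty_of_isProbabilityMeasure π)))
  have hKm := Scoring.measurable_kop κ hh
  have hKb : ∀ x, |Scoring.kop κ h x| ≤ Ch := Scoring.abs_kop_le κ hCh
  have hΦm : Measurable fun x : ℕ → S => (h (x 1) - Scoring.kop κ h (x 0)) ^ 2 :=
    ((hh.comp (measurable_pi_apply 1)).sub (hKm.comp (measurable_pi_apply 0))).pow_const 2
  have hΦb : ∀ x : ℕ → S, |(h (x 1) - Scoring.kop κ h (x 0)) ^ 2| ≤ (2 * Ch) ^ 2 := by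
    intro x
    rw [abs_pow]
    refine pow_le_pow_left₀ (abs_nonneg _) ?_ 2
    calc |h (x 1) - Scoring.kop κ h (x 0)| ≤ |h (x 1)| + |Scoring.kop κ h (x 0)| := abs_sub _ _
      _ ≤ Ch + Ch := add_le_add (hCh _) (hKb _)
      _ = 2 * Ch := by ring
  have hΦi : Integrable (fun x : ℕ → S => (h (x 1) - Scoring.kop κ h (x 0)) ^ 2) P :=
    Scoring.integrable_of_bounded P hΦm hΦb
  have hB := tendsto_sum_pair_div_ae_of_ergodic (P := P) hErg
    (φ := fun a b => (h b - Scoring.kop κ h a) ^ 2) hΦi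
  rwa [show ∫ y, (h (y 1) - Scoring.kop κ h (y 0)) ^ 2 ∂P
      = ∫ x, h x ^ 2 ∂π - ∫ x, (Scoring.kop κ h x) ^ 2 ∂π from by
        rw [hP]; exact chain_integral_increment_sq κ hπ hh hCh] at hB

variable {κ} {ν : Measure S} [IsProbabilityMeasure ν] {ε : ℝ≥0∞} {m : ℕ}

/-- **LLN for the squared increments from EVERY initial law under a Doeblin power**: if
`(nHit κ m)(z, ·) ≥ ε ν` for all `z` (`ε ≠ 0`) and `π` is invariant, then for every probability law
`μ₀`: `(1/n) Σ_{t<n} (h(x_{t+1}) − kop κ h (x_t))² → ∫ h² dπ − ∫ (kop κ h)² dπ` `P_{μ₀}`-a.s. -/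
theorem chain_incrementSq_anyLaw_of_nHit (hπ : Kernel.Invariant κ π) (hε : ε ≠ 0)
    (hmin : ∀ z, ε • ν ≤ nHit κ m z) {h : S → ℝ} (hh : Measurable h) {Ch : ℝ}
    (hCh : ∀ x, |h x| ≤ Ch) (μ₀ : Measure S) [IsProbabilityMeasure μ₀] :
    ∀ᵐ x ∂(Kernel.trajMeasure (X := fun _ : ℕ => S) μ₀
        (fun n : ℕ => κ.comap (fun hh : (i : ↥(Finset.Iic n)) → S => hh ⟨n, Finset.mem_Iic.2 le_rfl⟩)
          (measurable_pi_apply _))),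
      Tendsto (fun n : ℕ => (∑ t ∈ range n, (h (x (t + 1)) - Scoring.kop κ h (x t)) ^ 2) / n) atTop
        (𝓝 (∫ x, h x ^ 2 ∂π - ∫ x, (Scoring.kop κ h x) ^ 2 ∂π)) := by
  set L : ℝ := ∫ x, h x ^ 2 ∂π - ∫ x, (Scoring.kop κ h x) ^ 2 ∂π with hL
  have hKm := Scoring.measurable_kop κ hh
  -- the Cesàro event, measurable and shift-invariant
  have hA : MeasurableSet {x : ℕ → S | Tendsto (fun n : ℕ =>
      (∑ t ∈ range n, (h (x (t + 1)) - Scoring.kop κ h (x t)) ^ 2) / n) atTop (𝓝 L)} :=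
    measurableSet_tendsto (𝓝 L) fun n =>
      (Finset.measurable_sum (range n) fun t _ =>
        ((hh.comp (measurable_pi_apply _)).sub (hKm.comp (measurable_pi_apply _))).pow_const 2).div_const _
  have hinv : (fun (x : ℕ → S) (k : ℕ) => x (k + 1)) ⁻¹' {x : ℕ → S | Tendsto (fun n : ℕ =>
      (∑ t ∈ range n, (h (x (t + 1)) - Scoring.kop κ h (x t)) ^ 2) / n) atTop (𝓝 L)}
      = {x : ℕ → S | Tendsto (fun n : ℕ =>
        (∑ t ∈ range n, (h (x (t + 1)) - Scoring.kop κ h (x t)) ^ 2) / n) atTop (𝓝 L)} := by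
    ext x
    simp only [Set.mem_preimage, Set.mem_setOf_eq]
    exact tendsto_cesaro_shift_iff (fun p : S × S => (h p.2 - Scoring.kop κ h p.1) ^ 2)
      (fun t => (x t, x (t + 1))) L
  have hErg := ergodic_shift_chain_of_nHit_minorised (κ := κ) hπ hε
    (fun z t ht => minorised_setwise hmin z ht)
  have hπA : Kernel.trajMeasure (X := fun _ : ℕ => S) π
      (fun n : ℕ => κ.comap (fun hh : (i : ↥(Finset.Iic n)) → S => hh ⟨n, Finset.mem_Iic.2 le_rfl⟩)
        (measurable_pi_apply _)) {x : ℕ → S | Tendsto (fun n : ℕ =>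
        (∑ t ∈ range n, (h (x (t + 1)) - Scoring.kop κ h (x t)) ^ 2) / n) atTop (𝓝 L)} = 1 := by
    have h1 := chain_incrementSq_ae_of_ergodic κ hπ hErg hh hCh
    rw [ae_iff, ← Set.compl_setOf] at h1
    exact (prob_compl_eq_zero_iff hA).1 h1
  have h1 := trajMeasure_eq_one_of_nHit_minorised hπ hε hmin hA hinv hπA μ₀
  rw [ae_iff, ← Set.compl_setOf]
  exact (prob_compl_eq_zero_iff hA).2 h1

end Squares

end Summit.Ventures.LatticeQCDFlow.Exactness.GeneralNCMC
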